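import Literature.Probability.Percolation.TriUQuadFenceSteps
import HarnessLib

/-!
# The fences of a protected lowest crossing in the U-shaped half-annulus: all tip positions

Topic `Literature/Probability/Percolation`; family `crit-perc`, statement **crit-perc.S16**
(`Literature.Probability.Percolation.triTheta_exponent`). The deterministic "small extension" /
free-space step of Kesten's arm separation for the half-plane region `U_{k,N}` in the form of
P. Nolin, EJP 13 (2008), §4.2 Def. 6 and §4.4, proof of Lemma 15 [arXiv 0711.4948: Def. 6,
Lemma 14] ("by considering a black circuit in the annuli … we can construct a small extension"),
for every position of the tip `l` of the crossing on the inner arc.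

Abstract setting (no reference to the stage construction): `S ⊆ U ∩ ω` is the support of an
inner–outer crossing from `l ∈ uL` to `y ∈ uR` meeting the arc only at `l`; `P₀ ⊆ uLow S ∪ S` is
the examined set; `F` is a frame of scale `M` about `l` open in `ξ = ω ∪ (P₀ ∪ (U ∪ I)ᶜ)` (the
forced frame of `TriForcedFrame.lean`; `I = uInner k` is not forced). In each case the conclusion
exhibits a **fence** `X ⊆ I ∩ ω` — the tight support of a straight sub-crossing of one of the four
crossings of the frame, with its bounding rectangle — whose base point is joined to a site of `S`
by an `ω`-open path of `U ∪ I`; for tips on the right column near the real line, instead, a real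
point `x ∈ T` joined to `S` by an `ω`-open path of `U`.

* `uFence_topR` — tip on the top side with `l₀ - 2M ≥ -k + 1`: fence = the part below row `k`
  of the left crossing (route `SS, SE, SN, SW`).
* `uFence_topL` — tip on the top side with `l₀ - 2M ≤ -k`: fence = the part below row `k` of the
  right crossing (route `SE, SN, SW, SS`).
* `uFence_leftN` — tip on the left side with `l₁ + 2M ≤ k - 1` (frames dipping below the real
  line allowed): fence = the part right of the column `-k` of the top crossing (route `SN, SW, SS`).
* `uFence_leftS` — tip on the left side with `2M ≤ l₁`: fence = the part right of the column `-k`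
  of the bottom crossing (route `SE, SN, SW, SS`).
* `uFence_rightS` — tip on the right side with `2M ≤ l₁`: fence = the part left of the column `k`
  of the bottom crossing (route `SS, SE, SN, SW`).
* `uPoint_rightB` — tip on the right side with `l₁ < 2M`: the first real point of the right
  crossing after its last visit below the real line (route `SE⁺, SN`).

Mechanism (`TriUQuadFenceSteps.lean`): each route is a chain of `uStepA`/`uStepB` ending at a site
which is not high by its coordinates, so that the crossing `S` must have been met on the way.

## References

* P. Nolin, Near-critical percolation in two dimensions, *Electron. J. Probab.* 13 (2008), §4.2
  Def. 6, §4.4 proof of Lemma 15 [arXiv 0711.4948: Def. 6, Lemma 14] [Nolin2008].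
* H. Kesten, Scaling relations for 2D-percolation, *Comm. Math. Phys.* 109 (1987), Lemma 2
  [KestenScalingCMP1987].

## Mathlib / tree

Tree: `uStepA`, `uStepB`, `beyond_top`, `beyond_left`, `beyond_right`, `uHt_of_top`,
`uB_subset_uLow_union`, `not_uLow_of_mem_uT`, `mem_uSites_or_uInner` (`TriUQuadFenceSteps.lean`),
`FrameData` with its bounds, tightness and meeting lemmas (`ArmSeparationFrame.lean`,
`ArmSeparationIntFrame.lean`), `PathIn.exists_slab_crossing` (`TriPathCrossings.lean`),
`PathIn.tri_crossings_meet` (`TriCrossingsMeet.lean`), `PathIn.exists_support`, `PathIn.last_exit`.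
-/

noncomputable section

open Set

namespace Literature.Probability.Percolation

open LatticeModels

variable {k N : ℕ}

section Fences

variable {S P₀ ω : Set (Site 2)} {l y : Site 2} {M : ℕ}

/-- **Fence, top-side tip away from the left corner** (`l₁ = k`, `l₀ - 2M ≥ -k + 1`; `M ≥ 2`,
`2M ≤ k`, `k + 2M ≤ N`): the part of the left crossing of the frame below row `k` is a fence —
inside `I ∩ ω`, a top–bottom crossing of `[l₀ - 2M, l₀ - M] × [k - 2M, k - 1]`, its base joined
to `S` by an `ω`-open path of `U ∪ I`. [cite: Nolin2008, §4.2 Def. 6 and §4.4 proof of Lemma 15 (arXiv 0711.4948: Def. 6, Lemma 14)] [cite: KestenScalingCMP1987, Lemma 2] -/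
theorem uFence_topR (hk : 1 ≤ k) (hkN : k + 1 ≤ N) (hSU : S ⊆ ↑(uSites k N)) (hSω : S ⊆ ω)
    (hP₀ : P₀ ⊆ uLow k N S ∪ S) (honly : ∀ z ∈ S, z ∈ uL k N → z = l) (hl : l ∈ uL k N)
    (hy : y ∈ uR k N) (hpγ : PathIn triGraph S l y) (hM : 2 ≤ M) (hMk : 2 * M ≤ k)
    (hMN : k + 2 * M ≤ N) (hl1 : l 1 = k) (hl0 : -(k : ℤ) + 1 ≤ l 0 - 2 * M)
    (F : FrameData l M (ω ∪ (P₀ ∪ ((↑(uSites k N) : Set (Site 2)) ∪ uInner k)ᶜ))) :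
    ∃ (X : Set (Site 2)) (a b : Site 2), X ⊆ uInner k ∩ ω ∧
      (∀ v ∈ X, l 0 - 2 * M ≤ v 0 ∧ v 0 ≤ l 0 - M ∧ (k : ℤ) - 2 * M ≤ v 1 ∧ v 1 ≤ k - 1) ∧
      PathIn triGraph X a b ∧ a 1 = k - 2 * M ∧ b 1 = k - 1 ∧ (∀ v ∈ X, PathIn triGraph X a v) ∧
      ∃ g ∈ S, PathIn triGraph (ω ∩ (↑(uSites k N) ∪ uInner k)) a g := by
  classical
  set U : Set (Site 2) := ↑(uSites k N) with hUdef
  set I : Set (Site 2) := uInner k with hIdef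
  have hk' : (1 : ℤ) ≤ k := by exact_mod_cast hk
  have hM' : (2 : ℤ) ≤ M := by exact_mod_cast hM
  have hMk' : 2 * (M : ℤ) ≤ k := by exact_mod_cast hMk
  have hMN' : (k : ℤ) + 2 * M ≤ N := by exact_mod_cast hMN
  have hM1 : 1 ≤ M := le_trans (by norm_num) hM
  have hlS : l ∈ S := hpγ.left_mem
  have hl0' : l 0 ≤ (k : ℤ) - 1 := by have := (mem_uL_iff hk hkN).1 hl; omega
  have hHtl : uHt k l = 2 * k + l 0 := uHt_of_top hl1
  have hUI : ∀ v, v ∈ U → v ∈ I → False := fun v hvU hvI => (mem_coe_uSites.1 hvU).2 hvI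
  have hPU : P₀ ⊆ U := fun v hv => (hP₀ hv).elim (fun h => (uLow_subset h).1) (fun h => hSU h)
  have hIω : ∀ v ∈ I, v ∈ ω ∪ (P₀ ∪ (U ∪ I)ᶜ) → v ∈ ω := by
    rintro v hvI (hv | hv | hv)
    · exact hv
    · exact absurd hvI (fun hvI => hUI v (hPU hv) hvI)
    · exact absurd (Or.inr hvI) hv
  have UI_of : ∀ {z : Site 2}, -(N : ℤ) ≤ z 0 → z 0 ≤ N → 0 ≤ z 1 → z 1 ≤ N → z ∈ U ∨ z ∈ I :=
    fun h0 h0' h1 h1' => mem_uSites_or_uInner h0 h0' h1 h1'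
  -- the fence: the part of the left crossing below row `k`
  obtain ⟨a, b, ha1, hb1, hab⟩ := F.pathW.exists_slab_crossing 1 (L := (k : ℤ) - 2 * M) (R := k - 1)
    (by omega) (by have := F.xW1; omega) (by have := F.yW1; omega)
  obtain ⟨X, hXsub, hXab, hXtight⟩ := hab.exists_support
  have hXW : X ⊆ F.SW := fun v hv => (hXsub hv).1
  have bX : ∀ v ∈ X, l 0 - 2 * M ≤ v 0 ∧ v 0 ≤ l 0 - M ∧ (k : ℤ) - 2 * M ≤ v 1 ∧ v 1 ≤ k - 1 := by
    intro v hv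
    have h1 := F.boundsW (hXW hv)
    have h2 := (hXsub hv).2
    simp only [mem_setOf_eq] at h2
    omega
  have hXI : X ⊆ I := fun v hv => by
    have := bX v hv
    show v ∈ uInner k
    rw [mem_uInner]; omega
  have hXω : X ⊆ ω := fun v hv => hIω v (hXI hv) (F.SW_sub (hXW hv)).2
  refine ⟨X, a, b, fun v hv => ⟨hXI hv, hXω hv⟩, bX, hXab, ha1, hb1, hXtight, ?_⟩
  -- junction of the fence with the bottom crossing, inside `I`
  obtain ⟨c, d, hc1, hd1, hcd⟩ := hXab.exists_slab_crossing 1 (L := (k : ℤ) - 2 * M) (R := k - M)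
    (by omega) (by omega) (by omega)
  obtain ⟨j, hjX', hjS⟩ := PathIn.tri_crossings_meet' (L := l 0 - 2 * M) (R := l 0 + 2 * M)
    (B := (k : ℤ) - 2 * M) (T := (k : ℤ) - M)
    (A := X ∩ {z : Site 2 | (k : ℤ) - 2 * M ≤ z 1 ∧ z 1 ≤ k - M}) (A' := F.SS)
    (fun z hz => by
      have h1 := bX z hz.1
      have h2 := hz.2
      simp only [mem_setOf_eq] at h2
      omega)
    (fun z hz => by have := F.boundsS hz; omega) hcd hc1 hd1 F.pathS F.xS0 F.yS0
  have hjX : j ∈ X := hjX'.1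
  -- the crossings are open in `ξ`
  have hξS : F.SS ⊆ ω ∪ (P₀ ∪ (U ∪ I)ᶜ) := fun v hv => (F.SS_sub hv).2
  have hξE : F.SE ⊆ ω ∪ (P₀ ∪ (U ∪ I)ᶜ) := fun v hv => (F.SE_sub hv).2
  have hξN : F.SN ⊆ ω ∪ (P₀ ∪ (U ∪ I)ᶜ) := fun v hv => (F.SN_sub hv).2
  have hξW : F.SW ⊆ ω ∪ (P₀ ∪ (U ∪ I)ᶜ) := fun v hv => (F.SW_sub hv).2
  -- piece hypotheses, by coordinates
  have hSparc : ∀ b ∈ F.SS, b ∈ uL k N → uHt k l < uHt k b := by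
    intro b hb hbL
    have h := F.boundsS hb
    rw [mem_uL_iff hk hkN] at hbL
    rw [hHtl]; unfold uHt; split_ifs <;> omega
  have hSPI : ∀ a ∈ F.SS, a ∈ uInner k → ∀ b ∈ F.SS, triGraph.Adj a b → b ∈ U ∨ b ∈ I := by
    intro a _ _ b hb _
    have := F.boundsS hb
    exact UI_of (by omega) (by omega) (by omega) (by omega)
  have hSfake : ∀ a ∈ F.SS, ∀ b ∈ F.SS, triGraph.Adj a b → b ∉ U → b ∉ I → a ∈ U →
      a ∈ uLow k N S ∨ a ∈ S := by
    intro a _ b hb _ hbU hbI _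
    have := F.boundsS hb
    exact ((UI_of (by omega) (by omega) (by omega) (by omega)).elim hbU hbI).elim
  have hEparc : ∀ b ∈ F.SE, b ∈ uL k N → uHt k l < uHt k b := by
    intro b hb hbL
    have h := F.boundsE hb
    rw [mem_uL_iff hk hkN] at hbL
    rw [hHtl]; unfold uHt; split_ifs <;> omega
  have hEPI : ∀ a ∈ F.SE, a ∈ uInner k → ∀ b ∈ F.SE, triGraph.Adj a b → b ∈ U ∨ b ∈ I := by
    intro a _ _ b hb _
    have := F.boundsE hb
    exact UI_of (by omega) (by omega) (by omega) (by omega)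
  have hEfake : ∀ a ∈ F.SE, ∀ b ∈ F.SE, triGraph.Adj a b → b ∉ U → b ∉ I → a ∈ U →
      a ∈ uLow k N S ∨ a ∈ S := by
    intro a _ b hb _ hbU hbI _
    have := F.boundsE hb
    exact ((UI_of (by omega) (by omega) (by omega) (by omega)).elim hbU hbI).elim
  have hNBI : ∀ a ∈ uL k N, uHt k l < uHt k a → ∀ b ∈ F.SN, b ∈ uInner k → ¬ triGraph.Adj a b := by
    intro a _ _ b hb hbI _
    have := F.boundsN hb
    rw [mem_uInner] at hbI; omega
  have hNfake : ∀ a ∈ F.SN, ∀ b ∈ F.SN, triGraph.Adj a b → b ∉ U → b ∉ I → a ∈ U →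
      a ∈ uLow k N S ∨ a ∈ S := by
    intro a _ b hb _ hbU hbI _
    have := F.boundsN hb
    exact ((UI_of (by omega) (by omega) (by omega) (by omega)).elim hbU hbI).elim
  have hWBI : ∀ a ∈ uL k N, uHt k l < uHt k a → ∀ b ∈ F.SW, b ∈ uInner k → ¬ triGraph.Adj a b := by
    intro a haL hlt b hb _ hab
    have h0 := triGraph_adj_coord hab 0
    have hbW := F.boundsW hb
    rcases beyond_top hk hkN hl hl1 haL hlt with ⟨-, ha0, -⟩ | ⟨ha0, -, -⟩ <;> omega
  have hWfake : ∀ a ∈ F.SW, ∀ b ∈ F.SW, triGraph.Adj a b → b ∉ U → b ∉ I → a ∈ U →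
      a ∈ uLow k N S ∨ a ∈ S := by
    intro a _ b hb _ hbU hbI _
    have := F.boundsW hb
    exact ((UI_of (by omega) (by omega) (by omega) (by omega)).elim hbU hbI).elim
  -- the junctions of consecutive crossings
  obtain ⟨j₁, hj₁S, hj₁E⟩ := F.exists_mem_SS_SE hM1
  obtain ⟨j₂, hj₂N, hj₂E⟩ := F.exists_mem_SN_SE hM1
  obtain ⟨j₃, hj₃N, hj₃W⟩ := F.exists_mem_SN_SW hM1
  -- the route: `X → SS → SE → SN → SW → xW`, which must meet `S`
  have hacc₀ : PathIn triGraph (ω ∩ (U ∪ I)) a j :=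
    (hXtight j hjX).mono fun v hv => ⟨hXω hv, Or.inr (hXI hv)⟩
  rcases uStepA hk hkN hSU hSω hP₀ honly hl hy hpγ hξS hSparc hSPI hSfake (i₀ := a)
      (Or.inl ⟨hjS, hXI hjX⟩) hacc₀ ((F.tightS j hjS).symm.trans (F.tightS j₁ hj₁S)) with hgoal | ⟨hacc₁, hj₁⟩
  · exact hgoal
  have hj₁' : j₁ ∈ (F.SE ∩ uInner k) ∪ uHigh k N S := hj₁.elim (fun h => Or.inl ⟨hj₁E, h⟩) Or.inr
  rcases uStepA hk hkN hSU hSω hP₀ honly hl hy hpγ hξE hEparc hEPI hEfake hj₁' hacc₁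
      ((F.tightE j₁ hj₁E).symm.trans (F.tightE j₂ hj₂E)) with hgoal | ⟨hacc₂, hj₂⟩
  · exact hgoal
  have hj₂H : j₂ ∈ uHigh k N S := by
    rcases hj₂ with h | h
    · exfalso
      have := F.boundsN hj₂N
      rw [mem_uInner] at h; omega
    · exact h
  rcases uStepB hk hkN hSU hSω hP₀ honly hl hlS hξN hNBI hNfake hj₂H hacc₂
      ((F.tightN j₂ hj₂N).symm.trans (F.tightN j₃ hj₃N)) with hgoal | ⟨hacc₃, hj₃H⟩
  · exact hgoal
  rcases uStepB hk hkN hSU hSω hP₀ honly hl hlS hξW hWBI hWfake hj₃H hacc₃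
      (F.tightW j₃ hj₃W).symm with hgoal | ⟨-, hxH⟩
  · exact hgoal
  -- the base point of the left crossing is inside `I`: it cannot be high
  exfalso
  have hx := F.boundsW F.pathW.left_mem
  have hx1 := F.xW1
  refine hUI _ hxH.1 ?_
  show F.xW ∈ uInner k
  rw [mem_uInner]; omega


/-- **Fence, top-side tip near the left corner** (`l₁ = k`, `l₀ - 2M ≤ -k`; `M ≥ 2`, `2M + 1 ≤ k`,
`k + 2M ≤ N`): the part of the right crossing of the frame below row `k` is a fence — inside
`I ∩ ω`, a top–bottom crossing of `[l₀ + M, l₀ + 2M] × [k - 2M, k - 1]`, its base joined to `S`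
by an `ω`-open path of `U ∪ I`. [cite: Nolin2008, §4.2 Def. 6 and §4.4 proof of Lemma 15 (arXiv 0711.4948: Def. 6, Lemma 14)] [cite: KestenScalingCMP1987, Lemma 2] -/
theorem uFence_topL (hk : 1 ≤ k) (hkN : k + 1 ≤ N) (hSU : S ⊆ ↑(uSites k N)) (hSω : S ⊆ ω)
    (hP₀ : P₀ ⊆ uLow k N S ∪ S) (honly : ∀ z ∈ S, z ∈ uL k N → z = l) (hl : l ∈ uL k N)
    (hy : y ∈ uR k N) (hpγ : PathIn triGraph S l y) (hM : 2 ≤ M) (hMk : 2 * M + 1 ≤ k)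
    (hMN : k + 2 * M ≤ N) (hl1 : l 1 = k) (hl0 : l 0 - 2 * M ≤ -(k : ℤ))
    (F : FrameData l M (ω ∪ (P₀ ∪ ((↑(uSites k N) : Set (Site 2)) ∪ uInner k)ᶜ))) :
    ∃ (X : Set (Site 2)) (a b : Site 2), X ⊆ uInner k ∩ ω ∧
      (∀ v ∈ X, l 0 + M ≤ v 0 ∧ v 0 ≤ l 0 + 2 * M ∧ (k : ℤ) - 2 * M ≤ v 1 ∧ v 1 ≤ k - 1) ∧
      PathIn triGraph X a b ∧ a 1 = k - 2 * M ∧ b 1 = k - 1 ∧ (∀ v ∈ X, PathIn triGraph X a v) ∧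
      ∃ g ∈ S, PathIn triGraph (ω ∩ (↑(uSites k N) ∪ uInner k)) a g := by
  classical
  set U : Set (Site 2) := ↑(uSites k N) with hUdef
  set I : Set (Site 2) := uInner k with hIdef
  have hk' : (1 : ℤ) ≤ k := by exact_mod_cast hk
  have hM' : (2 : ℤ) ≤ M := by exact_mod_cast hM
  have hMk' : 2 * (M : ℤ) + 1 ≤ k := by exact_mod_cast hMk
  have hMN' : (k : ℤ) + 2 * M ≤ N := by exact_mod_cast hMN
  have hM1 : 1 ≤ M := le_trans (by norm_num) hM
  have hlS : l ∈ S := hpγ.left_mem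
  have hl0' : -(k : ℤ) ≤ l 0 := by have := (mem_uL_iff hk hkN).1 hl; omega
  have hHtl : uHt k l = 2 * k + l 0 := uHt_of_top hl1
  have hUI : ∀ v, v ∈ U → v ∈ I → False := fun v hvU hvI => (mem_coe_uSites.1 hvU).2 hvI
  have hPU : P₀ ⊆ U := fun v hv => (hP₀ hv).elim (fun h => (uLow_subset h).1) (fun h => hSU h)
  have hIω : ∀ v ∈ I, v ∈ ω ∪ (P₀ ∪ (U ∪ I)ᶜ) → v ∈ ω := by
    rintro v hvI (hv | hv | hv)
    · exact hv
    · exact absurd hvI (fun hvI => hUI v (hPU hv) hvI)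
    · exact absurd (Or.inr hvI) hv
  have UI_of : ∀ {z : Site 2}, -(N : ℤ) ≤ z 0 → z 0 ≤ N → 0 ≤ z 1 → z 1 ≤ N → z ∈ U ∨ z ∈ I :=
    fun h0 h0' h1 h1' => mem_uSites_or_uInner h0 h0' h1 h1'
  -- the fence: the part of the right crossing below row `k`
  obtain ⟨a, b, ha1, hb1, hab⟩ := F.pathE.exists_slab_crossing 1 (L := (k : ℤ) - 2 * M) (R := k - 1)
    (by omega) (by have := F.xE1; omega) (by have := F.yE1; omega)
  obtain ⟨X, hXsub, hXab, hXtight⟩ := hab.exists_support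
  have hXE : X ⊆ F.SE := fun v hv => (hXsub hv).1
  have bX : ∀ v ∈ X, l 0 + M ≤ v 0 ∧ v 0 ≤ l 0 + 2 * M ∧ (k : ℤ) - 2 * M ≤ v 1 ∧ v 1 ≤ k - 1 := by
    intro v hv
    have h1 := F.boundsE (hXE hv)
    have h2 := (hXsub hv).2
    simp only [mem_setOf_eq] at h2
    omega
  have hXI : X ⊆ I := fun v hv => by
    have := bX v hv
    show v ∈ uInner k
    rw [mem_uInner]; omega
  have hXω : X ⊆ ω := fun v hv => hIω v (hXI hv) (F.SE_sub (hXE hv)).2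
  refine ⟨X, a, b, fun v hv => ⟨hXI hv, hXω hv⟩, bX, hXab, ha1, hb1, hXtight, ?_⟩
  have haX : a ∈ X := hXab.left_mem
  -- the crossings are open in `ξ`
  have hξS : F.SS ⊆ ω ∪ (P₀ ∪ (U ∪ I)ᶜ) := fun v hv => (F.SS_sub hv).2
  have hξE : F.SE ⊆ ω ∪ (P₀ ∪ (U ∪ I)ᶜ) := fun v hv => (F.SE_sub hv).2
  have hξN : F.SN ⊆ ω ∪ (P₀ ∪ (U ∪ I)ᶜ) := fun v hv => (F.SN_sub hv).2
  have hξW : F.SW ⊆ ω ∪ (P₀ ∪ (U ∪ I)ᶜ) := fun v hv => (F.SW_sub hv).2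
  -- piece hypotheses, by coordinates
  have hEparc : ∀ b ∈ F.SE, b ∈ uL k N → uHt k l < uHt k b := by
    intro b hb hbL
    have h := F.boundsE hb
    rw [mem_uL_iff hk hkN] at hbL
    rw [hHtl]; unfold uHt; split_ifs <;> omega
  have hEPI : ∀ a ∈ F.SE, a ∈ uInner k → ∀ b ∈ F.SE, triGraph.Adj a b → b ∈ U ∨ b ∈ I := by
    intro a _ _ b hb _
    have := F.boundsE hb
    exact UI_of (by omega) (by omega) (by omega) (by omega)
  have hEfake : ∀ a ∈ F.SE, ∀ b ∈ F.SE, triGraph.Adj a b → b ∉ U → b ∉ I → a ∈ U →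
      a ∈ uLow k N S ∨ a ∈ S := by
    intro a _ b hb _ hbU hbI _
    have := F.boundsE hb
    exact ((UI_of (by omega) (by omega) (by omega) (by omega)).elim hbU hbI).elim
  have hNBI : ∀ a ∈ uL k N, uHt k l < uHt k a → ∀ b ∈ F.SN, b ∈ uInner k → ¬ triGraph.Adj a b := by
    intro a _ _ b hb hbI _
    have := F.boundsN hb
    rw [mem_uInner] at hbI; omega
  have hNfake : ∀ a ∈ F.SN, ∀ b ∈ F.SN, triGraph.Adj a b → b ∉ U → b ∉ I → a ∈ U →
      a ∈ uLow k N S ∨ a ∈ S := by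
    intro a _ b hb _ hbU hbI _
    have := F.boundsN hb
    exact ((UI_of (by omega) (by omega) (by omega) (by omega)).elim hbU hbI).elim
  have hWBI : ∀ a ∈ uL k N, uHt k l < uHt k a → ∀ b ∈ F.SW, b ∈ uInner k → ¬ triGraph.Adj a b := by
    intro a haL hlt b hb _ hab
    have h0 := triGraph_adj_coord hab 0
    have hbW := F.boundsW hb
    rcases beyond_top hk hkN hl hl1 haL hlt with ⟨-, ha0, -⟩ | ⟨ha0, -, -⟩ <;> omega
  have hWfake : ∀ a ∈ F.SW, ∀ b ∈ F.SW, triGraph.Adj a b → b ∉ U → b ∉ I → a ∈ U →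
      a ∈ uLow k N S ∨ a ∈ S := by
    intro a _ b hb _ hbU hbI _
    have := F.boundsW hb
    exact ((UI_of (by omega) (by omega) (by omega) (by omega)).elim hbU hbI).elim
  have hSBI : ∀ a ∈ uL k N, uHt k l < uHt k a → ∀ b ∈ F.SS, b ∈ uInner k → ¬ triGraph.Adj a b := by
    intro a haL hlt b hb _ hab
    have h0 := triGraph_adj_coord hab 0
    have h1 := triGraph_adj_coord hab 1
    have hbS := F.boundsS hb
    rcases beyond_top hk hkN hl hl1 haL hlt with ⟨ha1, ha0, -⟩ | ⟨ha0, -, -⟩ <;> omega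
  have hSfake : ∀ a ∈ F.SS, ∀ b ∈ F.SS, triGraph.Adj a b → b ∉ U → b ∉ I → a ∈ U →
      a ∈ uLow k N S ∨ a ∈ S := by
    intro a _ b hb _ hbU hbI _
    have := F.boundsS hb
    exact ((UI_of (by omega) (by omega) (by omega) (by omega)).elim hbU hbI).elim
  -- the junctions of consecutive crossings
  obtain ⟨j₁, hj₁S, hj₁E⟩ := F.exists_mem_SS_SE hM1
  obtain ⟨j₂, hj₂N, hj₂E⟩ := F.exists_mem_SN_SE hM1
  obtain ⟨j₃, hj₃N, hj₃W⟩ := F.exists_mem_SN_SW hM1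
  obtain ⟨j₄, hj₄S, hj₄W⟩ := F.exists_mem_SS_SW hM1
  -- the route: `X ⊆ SE → SN → SW → SS → j₁`, which must meet `S`
  have hacc₀ : PathIn triGraph (ω ∩ (U ∪ I)) a a := PathIn.refl ⟨hXω haX, Or.inr (hXI haX)⟩
  rcases uStepA hk hkN hSU hSω hP₀ honly hl hy hpγ hξE hEparc hEPI hEfake (i₀ := a)
      (Or.inl ⟨hXE haX, hXI haX⟩) hacc₀ ((F.tightE a (hXE haX)).symm.trans (F.tightE j₂ hj₂E))
      with hgoal | ⟨hacc₁, hj₂⟩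
  · exact hgoal
  have hj₂H : j₂ ∈ uHigh k N S := by
    rcases hj₂ with h | h
    · exfalso
      have := F.boundsN hj₂N
      rw [mem_uInner] at h; omega
    · exact h
  rcases uStepB hk hkN hSU hSω hP₀ honly hl hlS hξN hNBI hNfake hj₂H hacc₁
      ((F.tightN j₂ hj₂N).symm.trans (F.tightN j₃ hj₃N)) with hgoal | ⟨hacc₂, hj₃H⟩
  · exact hgoal
  rcases uStepB hk hkN hSU hSω hP₀ honly hl hlS hξW hWBI hWfake hj₃H hacc₂
      ((F.tightW j₃ hj₃W).symm.trans (F.tightW j₄ hj₄W)) with hgoal | ⟨hacc₃, hj₄H⟩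
  · exact hgoal
  rcases uStepB hk hkN hSU hSω hP₀ honly hl hlS hξS hSBI hSfake hj₄H hacc₃
      ((F.tightS j₄ hj₄S).symm.trans (F.tightS j₁ hj₁S)) with hgoal | ⟨-, hj₁H⟩
  · exact hgoal
  -- the junction of the bottom and right crossings is inside `I`: it cannot be high
  exfalso
  have h1 := F.boundsS hj₁S
  have h2 := F.boundsE hj₁E
  refine hUI _ hj₁H.1 ?_
  show j₁ ∈ uInner k
  rw [mem_uInner]; omega

/-- **Fence, left-side tip, from the top crossing** (`l₀ = -k`, `l₁ + 2M ≤ k - 1`; `M ≥ 1`,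
`k + 2M ≤ N`; the frame may dip below the real line): the part of the top crossing of the frame
to the right of the column `-k` is a fence — inside `I ∩ ω`, a left–right crossing of
`[-k + 1, -k + 2M] × [l₁ + M, l₁ + 2M]`, its base joined to `S` by an `ω`-open path of `U ∪ I`.
(Fake sites below the real line are harmless: a site of `U` next to one lies on the left real
segment, hence is low or on `S`.) [cite: Nolin2008, §4.2 Def. 6 and §4.4 proof of Lemma 15 (arXiv 0711.4948: Def. 6, Lemma 14)] [cite: KestenScalingCMP1987, Lemma 2] -/
theorem uFence_leftN (hk : 1 ≤ k) (hkN : k + 1 ≤ N) (hSU : S ⊆ ↑(uSites k N)) (hSω : S ⊆ ω)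
    (hP₀ : P₀ ⊆ uLow k N S ∪ S) (honly : ∀ z ∈ S, z ∈ uL k N → z = l) (hl : l ∈ uL k N)
    (hy : y ∈ uR k N) (hpγ : PathIn triGraph S l y) (hM : 1 ≤ M) (hMN : k + 2 * M ≤ N)
    (hl0 : l 0 = -(k : ℤ)) (ht : l 1 + 2 * M ≤ (k : ℤ) - 1)
    (F : FrameData l M (ω ∪ (P₀ ∪ ((↑(uSites k N) : Set (Site 2)) ∪ uInner k)ᶜ))) :
    ∃ (X : Set (Site 2)) (a b : Site 2), X ⊆ uInner k ∩ ω ∧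
      (∀ v ∈ X, -(k : ℤ) + 1 ≤ v 0 ∧ v 0 ≤ -(k : ℤ) + 2 * M ∧ l 1 + M ≤ v 1 ∧ v 1 ≤ l 1 + 2 * M) ∧
      PathIn triGraph X a b ∧ a 0 = -(k : ℤ) + 1 ∧ b 0 = -(k : ℤ) + 2 * M ∧
      (∀ v ∈ X, PathIn triGraph X a v) ∧
      ∃ g ∈ S, PathIn triGraph (ω ∩ (↑(uSites k N) ∪ uInner k)) a g := by
  classical
  set U : Set (Site 2) := ↑(uSites k N) with hUdef
  set I : Set (Site 2) := uInner k with hIdef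
  have hk' : (1 : ℤ) ≤ k := by exact_mod_cast hk
  have hM' : (1 : ℤ) ≤ M := by exact_mod_cast hM
  have hMN' : (k : ℤ) + 2 * M ≤ N := by exact_mod_cast hMN
  have hlS : l ∈ S := hpγ.left_mem
  have hl1' : 0 ≤ l 1 := by have := (mem_uL_iff hk hkN).1 hl; omega
  have hHtl : uHt k l = l 1 := by unfold uHt; rw [if_pos hl0]
  have hUI : ∀ v, v ∈ U → v ∈ I → False := fun v hvU hvI => (mem_coe_uSites.1 hvU).2 hvI
  have hPU : P₀ ⊆ U := fun v hv => (hP₀ hv).elim (fun h => (uLow_subset h).1) (fun h => hSU h)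
  have hIω : ∀ v ∈ I, v ∈ ω ∪ (P₀ ∪ (U ∪ I)ᶜ) → v ∈ ω := by
    rintro v hvI (hv | hv | hv)
    · exact hv
    · exact absurd hvI (fun hvI => hUI v (hPU hv) hvI)
    · exact absurd (Or.inr hvI) hv
  have UI_of : ∀ {z : Site 2}, -(N : ℤ) ≤ z 0 → z 0 ≤ N → 0 ≤ z 1 → z 1 ≤ N → z ∈ U ∨ z ∈ I :=
    fun h0 h0' h1 h1' => mem_uSites_or_uInner h0 h0' h1 h1'
  have hBlow : ∀ {a : Site 2}, a 1 = 0 → -(N : ℤ) ≤ a 0 → a 0 ≤ -(k : ℤ) → a ∈ uLow k N S ∨ a ∈ S :=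
    fun h1 h2 h3 => uB_subset_uLow_union hk S ⟨h1, h2, h3⟩
  -- the fence: the part of the top crossing right of the column `-k`
  obtain ⟨a, b, ha0, hb0, hab⟩ := F.pathN.exists_slab_crossing 0 (L := -(k : ℤ) + 1) (R := -(k : ℤ) + 2 * M)
    (by omega) (by have := F.xN0; omega) (by have := F.yN0; omega)
  obtain ⟨X, hXsub, hXab, hXtight⟩ := hab.exists_support
  have hXN : X ⊆ F.SN := fun v hv => (hXsub hv).1
  have bX : ∀ v ∈ X, -(k : ℤ) + 1 ≤ v 0 ∧ v 0 ≤ -(k : ℤ) + 2 * M ∧ l 1 + M ≤ v 1 ∧ v 1 ≤ l 1 + 2 * M := by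
    intro v hv
    have h1 := F.boundsN (hXN hv)
    have h2 := (hXsub hv).2
    simp only [mem_setOf_eq] at h2
    omega
  have hXI : X ⊆ I := fun v hv => by
    have := bX v hv
    show v ∈ uInner k
    rw [mem_uInner]; omega
  have hXω : X ⊆ ω := fun v hv => hIω v (hXI hv) (F.SN_sub (hXN hv)).2
  refine ⟨X, a, b, fun v hv => ⟨hXI hv, hXω hv⟩, bX, hXab, ha0, hb0, hXtight, ?_⟩
  have haX : a ∈ X := hXab.left_mem
  -- the crossings are open in `ξ`
  have hξS : F.SS ⊆ ω ∪ (P₀ ∪ (U ∪ I)ᶜ) := fun v hv => (F.SS_sub hv).2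
  have hξN : F.SN ⊆ ω ∪ (P₀ ∪ (U ∪ I)ᶜ) := fun v hv => (F.SN_sub hv).2
  have hξW : F.SW ⊆ ω ∪ (P₀ ∪ (U ∪ I)ᶜ) := fun v hv => (F.SW_sub hv).2
  -- piece hypotheses, by coordinates
  have hNparc : ∀ b ∈ F.SN, b ∈ uL k N → uHt k l < uHt k b := by
    intro b hb hbL
    have h := F.boundsN hb
    rw [mem_uL_iff hk hkN] at hbL
    rw [hHtl]; unfold uHt; split_ifs <;> omega
  have hNPI : ∀ a ∈ F.SN, a ∈ uInner k → ∀ b ∈ F.SN, triGraph.Adj a b → b ∈ U ∨ b ∈ I := by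
    intro a _ _ b hb _
    have := F.boundsN hb
    exact UI_of (by omega) (by omega) (by omega) (by omega)
  have hNfake : ∀ a ∈ F.SN, ∀ b ∈ F.SN, triGraph.Adj a b → b ∉ U → b ∉ I → a ∈ U →
      a ∈ uLow k N S ∨ a ∈ S := by
    intro a _ b hb _ hbU hbI _
    have := F.boundsN hb
    exact ((UI_of (by omega) (by omega) (by omega) (by omega)).elim hbU hbI).elim
  have hWBI : ∀ a ∈ uL k N, uHt k l < uHt k a → ∀ b ∈ F.SW, b ∈ uInner k → ¬ triGraph.Adj a b := by
    intro a _ _ b hb hbI _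
    have := F.boundsW hb
    rw [mem_uInner] at hbI; omega
  have hWfake : ∀ a ∈ F.SW, ∀ b ∈ F.SW, triGraph.Adj a b → b ∉ U → b ∉ I → a ∈ U →
      a ∈ uLow k N S ∨ a ∈ S := by
    intro a ha b hb hab hbU hbI haU
    have hbW := F.boundsW hb
    have haW := F.boundsW ha
    have hb1 : b 1 < 0 := by
      by_contra h
      push Not at h
      exact (UI_of (by omega) (by omega) h (by omega)).elim hbU hbI
    have ha' := (mem_coe_uSites.1 haU).1
    have h1 := triGraph_adj_coord hab 1
    exact hBlow (by omega) (by omega) (by omega)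
  have hSBI : ∀ a ∈ uL k N, uHt k l < uHt k a → ∀ b ∈ F.SS, b ∈ uInner k → ¬ triGraph.Adj a b := by
    intro a haL hlt b hb hbI hab
    have h0 := triGraph_adj_coord hab 0
    have h1 := triGraph_adj_coord hab 1
    have hbS := F.boundsS hb
    rw [mem_uInner] at hbI
    rcases beyond_left hk hkN hl0 haL hlt with ⟨ha0, ha1, -⟩ | ⟨ha1, -, -⟩ | ⟨ha0, -, -⟩ <;> omega
  have hSfake : ∀ a ∈ F.SS, ∀ b ∈ F.SS, triGraph.Adj a b → b ∉ U → b ∉ I → a ∈ U →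
      a ∈ uLow k N S ∨ a ∈ S := by
    intro a ha b hb hab hbU hbI haU
    have hbS := F.boundsS hb
    have haS := F.boundsS ha
    have hb1 : b 1 < 0 := by
      by_contra h
      push Not at h
      exact (UI_of (by omega) (by omega) h (by omega)).elim hbU hbI
    obtain ⟨ha', hanI⟩ := mem_coe_uSites.1 haU
    rw [mem_uInner] at hanI
    have h1 := triGraph_adj_coord hab 1
    exact hBlow (by omega) (by omega) (by omega)
  -- the junctions of consecutive crossings
  obtain ⟨j₁, hj₁S, hj₁E⟩ := F.exists_mem_SS_SE hM
  obtain ⟨j₃, hj₃N, hj₃W⟩ := F.exists_mem_SN_SW hM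
  obtain ⟨j₄, hj₄S, hj₄W⟩ := F.exists_mem_SS_SW hM
  -- the route: `X ⊆ SN → SW → SS → j₁`, which must meet `S`
  have hacc₀ : PathIn triGraph (ω ∩ (U ∪ I)) a a := PathIn.refl ⟨hXω haX, Or.inr (hXI haX)⟩
  rcases uStepA hk hkN hSU hSω hP₀ honly hl hy hpγ hξN hNparc hNPI hNfake (i₀ := a)
      (Or.inl ⟨hXN haX, hXI haX⟩) hacc₀ ((F.tightN a (hXN haX)).symm.trans (F.tightN j₃ hj₃N))
      with hgoal | ⟨hacc₁, hj₃⟩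
  · exact hgoal
  have hj₃H : j₃ ∈ uHigh k N S := by
    rcases hj₃ with h | h
    · exfalso
      have := F.boundsW hj₃W
      rw [mem_uInner] at h; omega
    · exact h
  rcases uStepB hk hkN hSU hSω hP₀ honly hl hlS hξW hWBI hWfake hj₃H hacc₁
      ((F.tightW j₃ hj₃W).symm.trans (F.tightW j₄ hj₄W)) with hgoal | ⟨hacc₂, hj₄H⟩
  · exact hgoal
  rcases uStepB hk hkN hSU hSω hP₀ honly hl hlS hξS hSBI hSfake hj₄H hacc₂
      ((F.tightS j₄ hj₄S).symm.trans (F.tightS j₁ hj₁S)) with hgoal | ⟨-, hj₁H⟩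
  · exact hgoal
  -- the junction of the bottom and right crossings is inside `I` or below the real line: not high
  exfalso
  have h1 := F.boundsS hj₁S
  have h2 := F.boundsE hj₁E
  obtain ⟨hj', hjnI⟩ := mem_coe_uSites.1 hj₁H.1
  rw [mem_uInner] at hjnI
  omega

/-- **Fence, left-side tip, from the bottom crossing** (`l₀ = -k`, `2M ≤ l₁ ≤ k - 1`; `M ≥ 1`,
`k + 2M ≤ N`): the part of the bottom crossing of the frame to the right of the column `-k` is a
fence — inside `I ∩ ω`, a left–right crossing of `[-k + 1, -k + 2M] × [l₁ - 2M, l₁ - M]`, its base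
joined to `S` by an `ω`-open path of `U ∪ I`. [cite: Nolin2008, §4.2 Def. 6 and §4.4 proof of Lemma 15 (arXiv 0711.4948: Def. 6, Lemma 14)] [cite: KestenScalingCMP1987, Lemma 2] -/
theorem uFence_leftS (hk : 1 ≤ k) (hkN : k + 1 ≤ N) (hSU : S ⊆ ↑(uSites k N)) (hSω : S ⊆ ω)
    (hP₀ : P₀ ⊆ uLow k N S ∪ S) (honly : ∀ z ∈ S, z ∈ uL k N → z = l) (hl : l ∈ uL k N)
    (hy : y ∈ uR k N) (hpγ : PathIn triGraph S l y) (hM : 1 ≤ M) (hMN : k + 2 * M ≤ N)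
    (hl0 : l 0 = -(k : ℤ)) (ht : 2 * (M : ℤ) ≤ l 1) (ht' : l 1 ≤ (k : ℤ) - 1)
    (F : FrameData l M (ω ∪ (P₀ ∪ ((↑(uSites k N) : Set (Site 2)) ∪ uInner k)ᶜ))) :
    ∃ (X : Set (Site 2)) (a b : Site 2), X ⊆ uInner k ∩ ω ∧
      (∀ v ∈ X, -(k : ℤ) + 1 ≤ v 0 ∧ v 0 ≤ -(k : ℤ) + 2 * M ∧ l 1 - 2 * M ≤ v 1 ∧ v 1 ≤ l 1 - M) ∧
      PathIn triGraph X a b ∧ a 0 = -(k : ℤ) + 1 ∧ b 0 = -(k : ℤ) + 2 * M ∧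
      (∀ v ∈ X, PathIn triGraph X a v) ∧
      ∃ g ∈ S, PathIn triGraph (ω ∩ (↑(uSites k N) ∪ uInner k)) a g := by
  classical
  set U : Set (Site 2) := ↑(uSites k N) with hUdef
  set I : Set (Site 2) := uInner k with hIdef
  have hk' : (1 : ℤ) ≤ k := by exact_mod_cast hk
  have hM' : (1 : ℤ) ≤ M := by exact_mod_cast hM
  have hMN' : (k : ℤ) + 2 * M ≤ N := by exact_mod_cast hMN
  have hlS : l ∈ S := hpγ.left_mem
  have hHtl : uHt k l = l 1 := by unfold uHt; rw [if_pos hl0]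
  have hUI : ∀ v, v ∈ U → v ∈ I → False := fun v hvU hvI => (mem_coe_uSites.1 hvU).2 hvI
  have hPU : P₀ ⊆ U := fun v hv => (hP₀ hv).elim (fun h => (uLow_subset h).1) (fun h => hSU h)
  have hIω : ∀ v ∈ I, v ∈ ω ∪ (P₀ ∪ (U ∪ I)ᶜ) → v ∈ ω := by
    rintro v hvI (hv | hv | hv)
    · exact hv
    · exact absurd hvI (fun hvI => hUI v (hPU hv) hvI)
    · exact absurd (Or.inr hvI) hv
  have UI_of : ∀ {z : Site 2}, -(N : ℤ) ≤ z 0 → z 0 ≤ N → 0 ≤ z 1 → z 1 ≤ N → z ∈ U ∨ z ∈ I :=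
    fun h0 h0' h1 h1' => mem_uSites_or_uInner h0 h0' h1 h1'
  -- the fence: the part of the bottom crossing right of the column `-k`
  obtain ⟨a, b, ha0, hb0, hab⟩ := F.pathS.exists_slab_crossing 0 (L := -(k : ℤ) + 1) (R := -(k : ℤ) + 2 * M)
    (by omega) (by have := F.xS0; omega) (by have := F.yS0; omega)
  obtain ⟨X, hXsub, hXab, hXtight⟩ := hab.exists_support
  have hXS : X ⊆ F.SS := fun v hv => (hXsub hv).1
  have bX : ∀ v ∈ X, -(k : ℤ) + 1 ≤ v 0 ∧ v 0 ≤ -(k : ℤ) + 2 * M ∧ l 1 - 2 * M ≤ v 1 ∧ v 1 ≤ l 1 - M := by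
    intro v hv
    have h1 := F.boundsS (hXS hv)
    have h2 := (hXsub hv).2
    simp only [mem_setOf_eq] at h2
    omega
  have hXI : X ⊆ I := fun v hv => by
    have := bX v hv
    show v ∈ uInner k
    rw [mem_uInner]; omega
  have hXω : X ⊆ ω := fun v hv => hIω v (hXI hv) (F.SS_sub (hXS hv)).2
  refine ⟨X, a, b, fun v hv => ⟨hXI hv, hXω hv⟩, bX, hXab, ha0, hb0, hXtight, ?_⟩
  have haX : a ∈ X := hXab.left_mem
  -- junction of the fence with the right crossing, inside `I`
  obtain ⟨c, d, hc1, hd1, hcd⟩ := F.pathE.exists_slab_crossing 1 (L := l 1 - 2 * M) (R := l 1 - M)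
    (by omega) (by have := F.xE1; omega) (by have := F.yE1; omega)
  obtain ⟨j, hjX, hjE'⟩ := PathIn.tri_crossings_meet (L := -(k : ℤ) + 1) (R := -(k : ℤ) + 2 * M)
    (B := l 1 - 2 * M) (T := l 1 - M) (A := X)
    (A' := F.SE ∩ {z : Site 2 | l 1 - 2 * M ≤ z 1 ∧ z 1 ≤ l 1 - M})
    (fun z hz => by have := bX z hz; omega)
    (fun z hz => by
      have h1 := F.boundsE hz.1
      have h2 := hz.2
      simp only [mem_setOf_eq] at h2
      omega)
    hXab ha0 hb0 hcd hc1 hd1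
  have hjE : j ∈ F.SE := hjE'.1
  -- the crossings are open in `ξ`
  have hξS : F.SS ⊆ ω ∪ (P₀ ∪ (U ∪ I)ᶜ) := fun v hv => (F.SS_sub hv).2
  have hξE : F.SE ⊆ ω ∪ (P₀ ∪ (U ∪ I)ᶜ) := fun v hv => (F.SE_sub hv).2
  have hξN : F.SN ⊆ ω ∪ (P₀ ∪ (U ∪ I)ᶜ) := fun v hv => (F.SN_sub hv).2
  have hξW : F.SW ⊆ ω ∪ (P₀ ∪ (U ∪ I)ᶜ) := fun v hv => (F.SW_sub hv).2
  -- piece hypotheses, by coordinates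
  have hEparc : ∀ b ∈ F.SE, b ∈ uL k N → uHt k l < uHt k b := by
    intro b hb hbL
    have h := F.boundsE hb
    rw [mem_uL_iff hk hkN] at hbL
    rw [hHtl]; unfold uHt; split_ifs <;> omega
  have hEPI : ∀ a ∈ F.SE, a ∈ uInner k → ∀ b ∈ F.SE, triGraph.Adj a b → b ∈ U ∨ b ∈ I := by
    intro a _ _ b hb _
    have := F.boundsE hb
    exact UI_of (by omega) (by omega) (by omega) (by omega)
  have hEfake : ∀ a ∈ F.SE, ∀ b ∈ F.SE, triGraph.Adj a b → b ∉ U → b ∉ I → a ∈ U →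
      a ∈ uLow k N S ∨ a ∈ S := by
    intro a _ b hb _ hbU hbI _
    have := F.boundsE hb
    exact ((UI_of (by omega) (by omega) (by omega) (by omega)).elim hbU hbI).elim
  have hNparc : ∀ b ∈ F.SN, b ∈ uL k N → uHt k l < uHt k b := by
    intro b hb hbL
    have h := F.boundsN hb
    rw [mem_uL_iff hk hkN] at hbL
    rw [hHtl]; unfold uHt; split_ifs <;> omega
  have hNPI : ∀ a ∈ F.SN, a ∈ uInner k → ∀ b ∈ F.SN, triGraph.Adj a b → b ∈ U ∨ b ∈ I := by
    intro a _ _ b hb _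
    have := F.boundsN hb
    exact UI_of (by omega) (by omega) (by omega) (by omega)
  have hNfake : ∀ a ∈ F.SN, ∀ b ∈ F.SN, triGraph.Adj a b → b ∉ U → b ∉ I → a ∈ U →
      a ∈ uLow k N S ∨ a ∈ S := by
    intro a _ b hb _ hbU hbI _
    have := F.boundsN hb
    exact ((UI_of (by omega) (by omega) (by omega) (by omega)).elim hbU hbI).elim
  have hWBI : ∀ a ∈ uL k N, uHt k l < uHt k a → ∀ b ∈ F.SW, b ∈ uInner k → ¬ triGraph.Adj a b := by
    intro a _ _ b hb hbI _
    have := F.boundsW hb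
    rw [mem_uInner] at hbI; omega
  have hWfake : ∀ a ∈ F.SW, ∀ b ∈ F.SW, triGraph.Adj a b → b ∉ U → b ∉ I → a ∈ U →
      a ∈ uLow k N S ∨ a ∈ S := by
    intro a _ b hb _ hbU hbI _
    have := F.boundsW hb
    exact ((UI_of (by omega) (by omega) (by omega) (by omega)).elim hbU hbI).elim
  have hSBI : ∀ a ∈ uL k N, uHt k l < uHt k a → ∀ b ∈ F.SS, b ∈ uInner k → ¬ triGraph.Adj a b := by
    intro a haL hlt b hb hbI hab
    have h0 := triGraph_adj_coord hab 0
    have h1 := triGraph_adj_coord hab 1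
    have hbS := F.boundsS hb
    rw [mem_uInner] at hbI
    rcases beyond_left hk hkN hl0 haL hlt with ⟨ha0, ha1, -⟩ | ⟨ha1, -, -⟩ | ⟨ha0, -, -⟩ <;> omega
  have hSfake : ∀ a ∈ F.SS, ∀ b ∈ F.SS, triGraph.Adj a b → b ∉ U → b ∉ I → a ∈ U →
      a ∈ uLow k N S ∨ a ∈ S := by
    intro a _ b hb _ hbU hbI _
    have := F.boundsS hb
    exact ((UI_of (by omega) (by omega) (by omega) (by omega)).elim hbU hbI).elim
  -- the junctions of consecutive crossings
  obtain ⟨j₂, hj₂N, hj₂E⟩ := F.exists_mem_SN_SE hM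
  obtain ⟨j₃, hj₃N, hj₃W⟩ := F.exists_mem_SN_SW hM
  obtain ⟨j₄, hj₄S, hj₄W⟩ := F.exists_mem_SS_SW hM
  -- the route: `X → SE → SN → SW → SS → a`, which must meet `S`
  have hacc₀ : PathIn triGraph (ω ∩ (U ∪ I)) a j :=
    (hXtight j hjX).mono fun v hv => ⟨hXω hv, Or.inr (hXI hv)⟩
  rcases uStepA hk hkN hSU hSω hP₀ honly hl hy hpγ hξE hEparc hEPI hEfake (i₀ := a)
      (Or.inl ⟨hjE, hXI hjX⟩) hacc₀ ((F.tightE j hjE).symm.trans (F.tightE j₂ hj₂E))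
      with hgoal | ⟨hacc₁, hj₂⟩
  · exact hgoal
  have hj₂' : j₂ ∈ (F.SN ∩ uInner k) ∪ uHigh k N S := hj₂.elim (fun h => Or.inl ⟨hj₂N, h⟩) Or.inr
  rcases uStepA hk hkN hSU hSω hP₀ honly hl hy hpγ hξN hNparc hNPI hNfake hj₂' hacc₁
      ((F.tightN j₂ hj₂N).symm.trans (F.tightN j₃ hj₃N)) with hgoal | ⟨hacc₂, hj₃⟩
  · exact hgoal
  have hj₃H : j₃ ∈ uHigh k N S := by
    rcases hj₃ with h | h
    · exfalso
      have := F.boundsW hj₃W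
      rw [mem_uInner] at h; omega
    · exact h
  rcases uStepB hk hkN hSU hSω hP₀ honly hl hlS hξW hWBI hWfake hj₃H hacc₂
      ((F.tightW j₃ hj₃W).symm.trans (F.tightW j₄ hj₄W)) with hgoal | ⟨hacc₃, hj₄H⟩
  · exact hgoal
  rcases uStepB hk hkN hSU hSω hP₀ honly hl hlS hξS hSBI hSfake hj₄H hacc₃
      ((F.tightS j₄ hj₄S).symm.trans (F.tightS a (hXS haX))) with hgoal | ⟨-, haH⟩
  · exact hgoal
  -- back at the base of the fence, inside `I`: it cannot be high
  exact (hUI _ haH.1 (hXI haX)).elim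

/-- **Fence, right-side tip, from the bottom crossing** (`l₀ = k`, `2M ≤ l₁`; `M ≥ 2`,
`k + 2M ≤ N`): the part of the bottom crossing of the frame to the left of the column `k` is a
fence — inside `I ∩ ω`, a left–right crossing of `[k - 2M, k - 1] × [l₁ - 2M, l₁ - M]`, its base
joined to `S` by an `ω`-open path of `U ∪ I`. [cite: Nolin2008, §4.2 Def. 6 and §4.4 proof of Lemma 15 (arXiv 0711.4948: Def. 6, Lemma 14)] [cite: KestenScalingCMP1987, Lemma 2] -/
theorem uFence_rightS (hk : 1 ≤ k) (hkN : k + 1 ≤ N) (hSU : S ⊆ ↑(uSites k N)) (hSω : S ⊆ ω)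
    (hP₀ : P₀ ⊆ uLow k N S ∪ S) (honly : ∀ z ∈ S, z ∈ uL k N → z = l) (hl : l ∈ uL k N)
    (hy : y ∈ uR k N) (hpγ : PathIn triGraph S l y) (hM : 2 ≤ M) (hMN : k + 2 * M ≤ N)
    (hl0 : l 0 = k) (ht : 2 * (M : ℤ) ≤ l 1)
    (F : FrameData l M (ω ∪ (P₀ ∪ ((↑(uSites k N) : Set (Site 2)) ∪ uInner k)ᶜ))) :
    ∃ (X : Set (Site 2)) (a b : Site 2), X ⊆ uInner k ∩ ω ∧
      (∀ v ∈ X, (k : ℤ) - 2 * M ≤ v 0 ∧ v 0 ≤ k - 1 ∧ l 1 - 2 * M ≤ v 1 ∧ v 1 ≤ l 1 - M) ∧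
      PathIn triGraph X a b ∧ a 0 = (k : ℤ) - 2 * M ∧ b 0 = (k : ℤ) - 1 ∧
      (∀ v ∈ X, PathIn triGraph X a v) ∧
      ∃ g ∈ S, PathIn triGraph (ω ∩ (↑(uSites k N) ∪ uInner k)) a g := by
  classical
  set U : Set (Site 2) := ↑(uSites k N) with hUdef
  set I : Set (Site 2) := uInner k with hIdef
  have hk' : (1 : ℤ) ≤ k := by exact_mod_cast hk
  have hM' : (2 : ℤ) ≤ M := by exact_mod_cast hM
  have hMN' : (k : ℤ) + 2 * M ≤ N := by exact_mod_cast hMN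
  have hM1 : 1 ≤ M := le_trans (by norm_num) hM
  have hlS : l ∈ S := hpγ.left_mem
  have hl1' : 0 ≤ l 1 ∧ l 1 ≤ (k : ℤ) - 1 := by have := (mem_uL_iff hk hkN).1 hl; omega
  have hHtl : uHt k l = 4 * k - 1 - l 1 := by
    unfold uHt; rw [if_neg (by omega), if_neg (by omega)]
  have hUI : ∀ v, v ∈ U → v ∈ I → False := fun v hvU hvI => (mem_coe_uSites.1 hvU).2 hvI
  have hPU : P₀ ⊆ U := fun v hv => (hP₀ hv).elim (fun h => (uLow_subset h).1) (fun h => hSU h)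
  have hIω : ∀ v ∈ I, v ∈ ω ∪ (P₀ ∪ (U ∪ I)ᶜ) → v ∈ ω := by
    rintro v hvI (hv | hv | hv)
    · exact hv
    · exact absurd hvI (fun hvI => hUI v (hPU hv) hvI)
    · exact absurd (Or.inr hvI) hv
  have UI_of : ∀ {z : Site 2}, -(N : ℤ) ≤ z 0 → z 0 ≤ N → 0 ≤ z 1 → z 1 ≤ N → z ∈ U ∨ z ∈ I :=
    fun h0 h0' h1 h1' => mem_uSites_or_uInner h0 h0' h1 h1'
  -- the fence: the part of the bottom crossing left of the column `k`
  obtain ⟨a, b, ha0, hb0, hab⟩ := F.pathS.exists_slab_crossing 0 (L := (k : ℤ) - 2 * M) (R := (k : ℤ) - 1)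
    (by omega) (by have := F.xS0; omega) (by have := F.yS0; omega)
  obtain ⟨X, hXsub, hXab, hXtight⟩ := hab.exists_support
  have hXS : X ⊆ F.SS := fun v hv => (hXsub hv).1
  have bX : ∀ v ∈ X, (k : ℤ) - 2 * M ≤ v 0 ∧ v 0 ≤ k - 1 ∧ l 1 - 2 * M ≤ v 1 ∧ v 1 ≤ l 1 - M := by
    intro v hv
    have h1 := F.boundsS (hXS hv)
    have h2 := (hXsub hv).2
    simp only [mem_setOf_eq] at h2
    omega
  have hXI : X ⊆ I := fun v hv => by
    have := bX v hv
    show v ∈ uInner k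
    rw [mem_uInner]; omega
  have hXω : X ⊆ ω := fun v hv => hIω v (hXI hv) (F.SS_sub (hXS hv)).2
  refine ⟨X, a, b, fun v hv => ⟨hXI hv, hXω hv⟩, bX, hXab, ha0, hb0, hXtight, ?_⟩
  have haX : a ∈ X := hXab.left_mem
  -- the crossings are open in `ξ`
  have hξS : F.SS ⊆ ω ∪ (P₀ ∪ (U ∪ I)ᶜ) := fun v hv => (F.SS_sub hv).2
  have hξE : F.SE ⊆ ω ∪ (P₀ ∪ (U ∪ I)ᶜ) := fun v hv => (F.SE_sub hv).2
  have hξN : F.SN ⊆ ω ∪ (P₀ ∪ (U ∪ I)ᶜ) := fun v hv => (F.SN_sub hv).2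
  have hξW : F.SW ⊆ ω ∪ (P₀ ∪ (U ∪ I)ᶜ) := fun v hv => (F.SW_sub hv).2
  -- piece hypotheses, by coordinates
  have hSparc : ∀ b ∈ F.SS, b ∈ uL k N → uHt k l < uHt k b := by
    intro b hb hbL
    have h := F.boundsS hb
    rw [mem_uL_iff hk hkN] at hbL
    rw [hHtl]; unfold uHt; split_ifs <;> omega
  have hSPI : ∀ a ∈ F.SS, a ∈ uInner k → ∀ b ∈ F.SS, triGraph.Adj a b → b ∈ U ∨ b ∈ I := by
    intro a _ _ b hb _
    have := F.boundsS hb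
    exact UI_of (by omega) (by omega) (by omega) (by omega)
  have hSfake : ∀ a ∈ F.SS, ∀ b ∈ F.SS, triGraph.Adj a b → b ∉ U → b ∉ I → a ∈ U →
      a ∈ uLow k N S ∨ a ∈ S := by
    intro a _ b hb _ hbU hbI _
    have := F.boundsS hb
    exact ((UI_of (by omega) (by omega) (by omega) (by omega)).elim hbU hbI).elim
  have hEBI : ∀ a ∈ uL k N, uHt k l < uHt k a → ∀ b ∈ F.SE, b ∈ uInner k → ¬ triGraph.Adj a b := by
    intro a _ _ b hb hbI _
    have := F.boundsE hb
    rw [mem_uInner] at hbI; omega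
  have hEfake : ∀ a ∈ F.SE, ∀ b ∈ F.SE, triGraph.Adj a b → b ∉ U → b ∉ I → a ∈ U →
      a ∈ uLow k N S ∨ a ∈ S := by
    intro a _ b hb _ hbU hbI _
    have := F.boundsE hb
    exact ((UI_of (by omega) (by omega) (by omega) (by omega)).elim hbU hbI).elim
  have hNBI : ∀ a ∈ uL k N, uHt k l < uHt k a → ∀ b ∈ F.SN, b ∈ uInner k → ¬ triGraph.Adj a b := by
    intro a haL hlt b hb _ hab
    have h1 := triGraph_adj_coord hab 1
    have hbN := F.boundsN hb
    have := beyond_right hk hkN hl0 hl1'.2 haL hlt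
    omega
  have hNfake : ∀ a ∈ F.SN, ∀ b ∈ F.SN, triGraph.Adj a b → b ∉ U → b ∉ I → a ∈ U →
      a ∈ uLow k N S ∨ a ∈ S := by
    intro a _ b hb _ hbU hbI _
    have := F.boundsN hb
    exact ((UI_of (by omega) (by omega) (by omega) (by omega)).elim hbU hbI).elim
  have hWBI : ∀ a ∈ uL k N, uHt k l < uHt k a → ∀ b ∈ F.SW, b ∈ uInner k → ¬ triGraph.Adj a b := by
    intro a haL hlt b hb _ hab
    have h0 := triGraph_adj_coord hab 0
    have hbW := F.boundsW hb
    have := beyond_right hk hkN hl0 hl1'.2 haL hlt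
    omega
  have hWfake : ∀ a ∈ F.SW, ∀ b ∈ F.SW, triGraph.Adj a b → b ∉ U → b ∉ I → a ∈ U →
      a ∈ uLow k N S ∨ a ∈ S := by
    intro a _ b hb _ hbU hbI _
    have := F.boundsW hb
    exact ((UI_of (by omega) (by omega) (by omega) (by omega)).elim hbU hbI).elim
  -- the junctions of consecutive crossings
  obtain ⟨j₁, hj₁S, hj₁E⟩ := F.exists_mem_SS_SE hM1
  obtain ⟨j₂, hj₂N, hj₂E⟩ := F.exists_mem_SN_SE hM1
  obtain ⟨j₃, hj₃N, hj₃W⟩ := F.exists_mem_SN_SW hM1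
  -- the route: `X ⊆ SS → SE → SN → SW → xW`, which must meet `S`
  have hacc₀ : PathIn triGraph (ω ∩ (U ∪ I)) a a := PathIn.refl ⟨hXω haX, Or.inr (hXI haX)⟩
  rcases uStepA hk hkN hSU hSω hP₀ honly hl hy hpγ hξS hSparc hSPI hSfake (i₀ := a)
      (Or.inl ⟨hXS haX, hXI haX⟩) hacc₀ ((F.tightS a (hXS haX)).symm.trans (F.tightS j₁ hj₁S))
      with hgoal | ⟨hacc₁, hj₁⟩
  · exact hgoal
  have hj₁H : j₁ ∈ uHigh k N S := by
    rcases hj₁ with h | h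
    · exfalso
      have := F.boundsE hj₁E
      rw [mem_uInner] at h; omega
    · exact h
  rcases uStepB hk hkN hSU hSω hP₀ honly hl hlS hξE hEBI hEfake hj₁H hacc₁
      ((F.tightE j₁ hj₁E).symm.trans (F.tightE j₂ hj₂E)) with hgoal | ⟨hacc₂, hj₂H⟩
  · exact hgoal
  rcases uStepB hk hkN hSU hSω hP₀ honly hl hlS hξN hNBI hNfake hj₂H hacc₂
      ((F.tightN j₂ hj₂N).symm.trans (F.tightN j₃ hj₃N)) with hgoal | ⟨hacc₃, hj₃H⟩
  · exact hgoal
  rcases uStepB hk hkN hSU hSω hP₀ honly hl hlS hξW hWBI hWfake hj₃H hacc₃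
      (F.tightW j₃ hj₃W).symm with hgoal | ⟨-, hxH⟩
  · exact hgoal
  -- the base point of the left crossing is inside `I`: it cannot be high
  exfalso
  have hx := F.boundsW F.pathW.left_mem
  have hx1 := F.xW1
  refine hUI _ hxH.1 ?_
  show F.xW ∈ uInner k
  rw [mem_uInner]; omega

/-- **Real point, right-side tip near the real line** (`l₀ = k`, `l₁ < 2M`, `l₁ + 2M ≤ k - 1`;
`M ≥ 1`, `k + 2M ≤ N`): the right crossing of the frame, followed from its last visit below the
real line, starts at a real point `x ∈ T` with `k + M ≤ x₀ ≤ k + 2M` which is on `S` or joined to a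
site of `S` by an `ω`-open path of `U` (real points of `T` are never low, by the quad's `meet`
property; route: the real part of `SE`, then `SN`). [cite: Nolin2008, §4.2 Def. 6 and §4.4 proof of Lemma 15 (arXiv 0711.4948: Def. 6, Lemma 14)] [cite: KestenScalingCMP1987, Lemma 2] -/
theorem uPoint_rightB (hk : 1 ≤ k) (hkN : k + 1 ≤ N) (hSU : S ⊆ ↑(uSites k N)) (hSω : S ⊆ ω)
    (hP₀ : P₀ ⊆ uLow k N S ∪ S) (honly : ∀ z ∈ S, z ∈ uL k N → z = l) (hl : l ∈ uL k N)
    (hy : y ∈ uR k N) (hpγ : PathIn triGraph S l y) (hM : 1 ≤ M) (hMN : k + 2 * M ≤ N)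
    (hl0 : l 0 = k) (ht : l 1 < 2 * (M : ℤ)) (htk : l 1 + 2 * M ≤ (k : ℤ) - 1)
    (F : FrameData l M (ω ∪ (P₀ ∪ ((↑(uSites k N) : Set (Site 2)) ∪ uInner k)ᶜ))) :
    ∃ x : Site 2, x 1 = 0 ∧ (k : ℤ) + M ≤ x 0 ∧ x 0 ≤ k + 2 * M ∧
      ∃ g ∈ S, PathIn triGraph (ω ∩ (↑(uSites k N) ∪ uInner k)) x g := by
  classical
  set U : Set (Site 2) := ↑(uSites k N) with hUdef
  set I : Set (Site 2) := uInner k with hIdef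
  have hk' : (1 : ℤ) ≤ k := by exact_mod_cast hk
  have hM' : (1 : ℤ) ≤ M := by exact_mod_cast hM
  have hMN' : (k : ℤ) + 2 * M ≤ N := by exact_mod_cast hMN
  have hlS : l ∈ S := hpγ.left_mem
  have hl1' : 0 ≤ l 1 ∧ l 1 ≤ (k : ℤ) - 1 := by have := (mem_uL_iff hk hkN).1 hl; omega
  have hUI : ∀ v, v ∈ U → v ∈ I → False := fun v hvU hvI => (mem_coe_uSites.1 hvU).2 hvI
  have UI_of : ∀ {z : Site 2}, -(N : ℤ) ≤ z 0 → z 0 ≤ N → 0 ≤ z 1 → z 1 ≤ N → z ∈ U ∨ z ∈ I :=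
    fun h0 h0' h1 h1' => mem_uSites_or_uInner h0 h0' h1 h1'
  -- the real part of the right crossing after its last visit below the real line
  obtain ⟨e, x, heC, -, hxC, hex, hp⟩ := F.pathE.last_exit (C := {z : Site 2 | z 1 < 0})
    (by show F.xE 1 < 0; have := F.xE1; omega) (by show ¬ F.yE 1 < 0; have := F.yE1; omega)
  have heC' : e 1 < 0 := heC
  have hxC' : ¬ x 1 < 0 := hxC
  have hx1 : x 1 = 0 := by have := triGraph_adj_coord hex 1; omega
  have hxE : x ∈ F.SE := hp.left_mem.1
  have hxb := F.boundsE hxE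
  obtain ⟨P', hP'sub, hP'p, hP'tight⟩ := hp.exists_support
  refine ⟨x, hx1, by omega, by omega, ?_⟩
  have hxT : x ∈ uT k N := ⟨hx1, by omega, by omega⟩
  have hxU : x ∈ U := uT_subset hk hxT
  by_cases hxS : x ∈ S
  · exact ⟨x, hxS, PathIn.refl ⟨hSω hxS, Or.inl hxU⟩⟩
  have hxH : x ∈ uHigh k N S := ⟨hxU, not_uLow_of_mem_uT hk hkN hSU hl hy hpγ hxT, hxS⟩
  have hξP : P' ⊆ ω ∪ (P₀ ∪ (U ∪ I)ᶜ) := fun v hv => (F.SE_sub (hP'sub hv).1).2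
  have hξN : F.SN ⊆ ω ∪ (P₀ ∪ (U ∪ I)ᶜ) := fun v hv => (F.SN_sub hv).2
  have hxω : x ∈ ω := (pieceB_subset_open hSU hP₀ hξP ⟨hP'p.left_mem, hxH⟩).1
  have hacc₀ : PathIn triGraph (ω ∩ (U ∪ I)) x x := PathIn.refl ⟨hxω, Or.inl hxU⟩
  -- bounds of the real part
  have bP : ∀ v ∈ P', l 0 + M ≤ v 0 ∧ v 0 ≤ l 0 + 2 * M ∧ 0 ≤ v 1 ∧ v 1 ≤ l 1 + 2 * M := by
    intro v hv
    have h1 := F.boundsE (hP'sub hv).1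
    have h2 : ¬ v 1 < 0 := (hP'sub hv).2
    omega
  -- junction with the top crossing
  obtain ⟨c, d, hc1, hd1, hcd⟩ := hP'p.exists_slab_crossing 1 (L := l 1 + M) (R := l 1 + 2 * M)
    (by omega) (by omega) (by have := F.yE1; omega)
  obtain ⟨j₂, hj₂P', hj₂N⟩ := PathIn.tri_crossings_meet' (L := l 0 - 2 * M) (R := l 0 + 2 * M)
    (B := l 1 + M) (T := l 1 + 2 * M)
    (A := P' ∩ {z : Site 2 | l 1 + M ≤ z 1 ∧ z 1 ≤ l 1 + 2 * M}) (A' := F.SN)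
    (fun z hz => by
      have h1 := bP z hz.1
      have h2 := hz.2
      simp only [mem_setOf_eq] at h2
      omega)
    (fun z hz => by have := F.boundsN hz; omega) hcd hc1 hd1 F.pathN F.xN0 F.yN0
  have hj₂P : j₂ ∈ P' := hj₂P'.1
  -- piece hypotheses
  have hPBI : ∀ a ∈ uL k N, uHt k l < uHt k a → ∀ b ∈ P', b ∈ uInner k → ¬ triGraph.Adj a b := by
    intro a _ _ b hb hbI _
    have := bP b hb
    rw [mem_uInner] at hbI; omega
  have hPfake : ∀ a ∈ P', ∀ b ∈ P', triGraph.Adj a b → b ∉ U → b ∉ I → a ∈ U →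
      a ∈ uLow k N S ∨ a ∈ S := by
    intro a _ b hb _ hbU hbI _
    have := bP b hb
    exact ((UI_of (by omega) (by omega) (by omega) (by omega)).elim hbU hbI).elim
  have hNBI : ∀ a ∈ uL k N, uHt k l < uHt k a → ∀ b ∈ F.SN, b ∈ uInner k → ¬ triGraph.Adj a b := by
    intro a haL hlt b hb _ hab
    have h1 := triGraph_adj_coord hab 1
    have hbN := F.boundsN hb
    have := beyond_right hk hkN hl0 hl1'.2 haL hlt
    omega
  have hNfake : ∀ a ∈ F.SN, ∀ b ∈ F.SN, triGraph.Adj a b → b ∉ U → b ∉ I → a ∈ U →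
      a ∈ uLow k N S ∨ a ∈ S := by
    intro a _ b hb _ hbU hbI _
    have := F.boundsN hb
    exact ((UI_of (by omega) (by omega) (by omega) (by omega)).elim hbU hbI).elim
  -- the route: `P' → SN → xN`, which must meet `S`
  rcases uStepB hk hkN hSU hSω hP₀ honly hl hlS hξP hPBI hPfake (i₀ := x) hxH hacc₀
      (hP'tight j₂ hj₂P) with hgoal | ⟨hacc₁, hj₂H⟩
  · exact hgoal
  rcases uStepB hk hkN hSU hSω hP₀ honly hl hlS hξN hNBI hNfake hj₂H hacc₁
      (F.tightN j₂ hj₂N).symm with hgoal | ⟨-, hxNH⟩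
  · exact hgoal
  -- the base point of the top crossing is inside `I`: it cannot be high
  exfalso
  have hx := F.boundsN F.pathN.left_mem
  have hx0 := F.xN0
  refine hUI _ hxNH.1 ?_
  show F.xN ∈ uInner k
  rw [mem_uInner]; omega

end Fences

end Literature.Probability.Percolation
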